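import Summits.BirchSwinnertonDyer.BirchSwinnertonDyer.Theorems.GoldfeldAllTwistsTwoConverseTwinAdditiveGenusIndexLaw
import Summits.BirchSwinnertonDyer.BirchSwinnertonDyer.Theorems.GoldfeldAllTwistsTwoConverseTwinGenusFieldDescent
import Summits.BirchSwinnertonDyer.Rank1Residual.X11b.RingClassFieldConj
import Literature.NumberTheory.EllipticCurves.RingClassFieldConjugation
import Literature.NumberTheory.EllipticCurves.HeegnerPointsGaloisDescent
import Literature.NumberTheory.EllipticCurves.MordellWeilRankZeroProofs
import HarnessLib

set_option linter.dupNamespace false -- `…BirchSwinnertonDyer.BirchSwinnertonDyer…` is the cell's namespace (D-0017)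
set_option autoImplicit false

/-!
# Twin″ (item 19140), the `7`-INERT half of the additive cell — XI: CONJUGATION-FREE GALOIS DESCENT of `±`-eigenpoints
# of `X₀(49)` over the Hilbert class field `H = K[1]` through the twist substitution, and the CORE decomposition
# `2P = Q_a + Q_n` behind the MEMBERSHIP of the genus point (sequel XII `…TwinAdditiveGenusMembership`)

Cell `bsd-goldfeld`, seat `bsd-goldfeld-s1p-c301` (prover, gen 12); planner g36 (clxiv) candidate (M), self-assigned within
the gen-12 seat (STATUS «NEXT»). Support for item `stmt-BirchSwinnertonDyer-19140` (crux twin″ `BSDTwoCMSevenAdditiveRankOne`).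
Theses-free; theorems only; no `sorry`, no definition, no new fact. HONEST FRAMING: Galois bookkeeping on `X₀(49)(H)`, `H = K[1]`
for an imaginary quadratic `K`, with ONE printed input in §3 (Coates–Li–Tian–Zhai 2015 Thm 1.2 `thm12_fullBSD_twist`, binder
`h12`: `49a1^{(a)}(ℚ)` is finite for a prime `a ≡ 1 (mod 4)` inert in `ℚ(√−7)`); nothing about `L`-values; no case of
twin″ or BSD is claimed. NO Shimura reciprocity, NO complex-conjugation law on Heegner points is used: only the structure
`Aut(H/ℚ) = 𝒢 ⊔ ρ𝒢` with `ρ γ ρ⁻¹ = γ⁻¹` (Cox Lemma 9.3; tree `inv_mul_mem_ringClassGal_of_not_mem`,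
`mul_mul_inv_eq_inv_of_not_mem_ringClassGal`, `isGalois_rat_ringClassField`, `exists_conj_algEquiv`).

## Contents (`𝒢 = ringClassGal ι 1 = Gal(H/K)`, `s : 𝒢 → ℤˣ`, `P_χ = Σ_{γ ∈ 𝒢} s(γ)·γy`)
* §1 `pointGalHom_genusSum_of_mem` (`γ P_χ = s(γ) P_χ`, `s` multiplicative), `pointGalHom_genusSum_of_not_mem`
  (`γ (ρ P_χ) = s(γ) ρ P_χ` for `ρ ∉ 𝒢`), and **`pointGalHom_add_involution_of_sign`**: for an involution `ρ ∉ 𝒢` fixing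
  `u` (`u² ∈ ℚ`, `u ≠ 0`) whose cut-out character on `𝒢` is `s` (`γ u = u ⟺ s γ = 1`), and `P` with the two laws above,
  EVERY `σ ∈ Aut(H/ℚ)` acts on `Q_ρ = P + ρP` by `+1` if `σ u = u` and by `−1` otherwise.
* §2 **`exists_twist_point_of_forall_pointGalHom`**: such a `±`-eigenpoint `Q` is `Φ_H(ι_H(z))` with `z` RATIONAL on the twist
  `X₀(49)^{(u²)}` — `Φ_H⁻¹ Q` is `Aut(H/ℚ)`-fixed by the (anti-)naturality of the twist substitution `Φ_H` (cell `b2b-bsdres`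
  `twistPointEquivOver`), and `H/ℚ` is Galois, so `exists_map_eq_of_forall_map_galois_eq` applies.
* §3 `sign_mul_of_cutout`, `finite_point_cm7_quadraticTwist_prime` (`h12`), and the CORE
  **`two_smul_eq_twist_add_torsion_of_involutions`**: two involutions `ρ_a, ρ_n ∉ 𝒢` fixing `r₀` (`r₀² = a`) resp. `t`
  (`t² = n`), both with cut-out character `s`, and `ρ_a P + ρ_n P = 0` ⟹ `2P = Φ_H^{(t)}(ι z) + T`, `z ∈ X₀(49)^{(n)}(ℚ)`, `T` of
  finite order (`= Φ_H^{(r₀)}(ι z_a)`, `z_a` in the finite group `X₀(49)^{(a)}(ℚ)`).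

DECIDABILITY. Point groups over `H` depend on a `DecidableEq H` instance: the exported statements take it as a binder `hdec`
(so that they instantiate in seat c201's / file IX's world); §§2–3 prove them after specialising `hdec` to the classical
instance of the generic tree lemmas (a subsingleton) — seat c3's device (`…TwinGenusHeightRatio`).

References: D. Cox, *Primes of the form x² + ny²* (2013) Lemma 9.3 [Cox2013]; B. Gross, in *Modular forms* (1984) §§4–5
[Gross1984]; J. Coates, Y. Li, Y. Tian, S. Zhai, PLMS 110 (2015) Thm 1.2 [CoatesLiTianZhai2015]; J. H. Silverman, AEC (2009)
I.§1, X.2, VIII.6 [SilvermanAEC2009]; T. Dokchitser, *Notes on the parity conjecture* (2013) §4 [Dokchitser2013ParityNotes].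
-/

noncomputable section

open scoped Classical

open NumberField WeierstrassCurve Field Literature.NumberTheory.EllipticCurves
  Literature.NumberTheory.EllipticCurves.ModularForms
  Literature.NumberTheory.EllipticCurves.CaiShuTian2014
  Literature.NumberTheory.GaloisRepresentations
  Summit.BirchSwinnertonDyer.Rank1Residual.AdditivePotMult
  Summit.BirchSwinnertonDyer.Rank1Residual.X11b.RingClassConj

namespace Summit.BirchSwinnertonDyer.BirchSwinnertonDyer.Theorems.GoldfeldGoodTwists

/-! ## §1 The sign character on the genus point: `γ P_χ = s(γ) P_χ`, and involutions outside `Gal(H/K)` -/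

section SignAction

variable {K : Type} [Field K] [NumberField K] {ι : K →+* ℂ}
  [hdec : DecidableEq (ringClassField K ι 1)]
  (s : ringClassGal ι 1 → ℤˣ) (hsmul : ∀ γ σ : ringClassGal ι 1, s (γ * σ) = s γ * s σ)
  (y : (cm7.baseChange (ringClassField K ι 1 : Type)).toAffine.Point)

omit hdec in
include hsmul in
/-- `s γ⁻¹ = s γ` for a multiplicative `{±1}`-valued function on `Gal(H/K)` (`s 1 = 1`, `u² = 1` in `ℤˣ`). [folklore] -/
theorem sign_inv_eq (γ : ringClassGal ι 1) : s γ⁻¹ = s γ := by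
  have h1 : s 1 = 1 := by
    have h := hsmul 1 1
    rw [one_mul] at h
    exact left_eq_mul.mp h
  have h := hsmul γ⁻¹ γ
  rw [inv_mul_cancel, h1] at h
  have hsq : s γ * s γ = 1 := Int.units_mul_self (s γ)
  exact mul_right_cancel (h.symm.trans hsq.symm)

include hsmul in
/-- **`𝒢`-isotypy of the genus point: `γ • P_χ = s(γ) • P_χ`** for `γ ∈ 𝒢 = Gal(H/K)`, `P_χ = Σ_σ s(σ)·σy`
(reindex the sum by `σ ↦ γ⁻¹σ`; `s` multiplicative, `s(γ⁻¹) = s(γ)`). [cite: Gross1984, §§4–5] -/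
theorem pointGalHom_genusSum_of_mem [NumberField (ringClassField K ι 1)] (γ : ringClassGal ι 1) :
    pointGalHom cm7 (ringClassField K ι 1 : Type) γ.1
        (∑ σ : ringClassGal ι 1, (s σ : ℤ) • pointGalHom cm7 (ringClassField K ι 1 : Type) σ.1 y) =
      (s γ : ℤ) • ∑ σ : ringClassGal ι 1, (s σ : ℤ) • pointGalHom cm7 (ringClassField K ι 1 : Type) σ.1 y := by
  rw [map_sum, Finset.smul_sum]
  simp_rw [map_zsmul]
  have hmul : ∀ σ : ringClassGal ι 1,
      pointGalHom cm7 (ringClassField K ι 1 : Type) γ.1 (pointGalHom cm7 (ringClassField K ι 1 : Type) σ.1 y) =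
        pointGalHom cm7 (ringClassField K ι 1 : Type) (γ * σ).1 y := by
    intro σ
    rw [Subgroup.coe_mul, map_mul]
    rfl
  simp_rw [hmul]
  -- reindex `σ ↦ γσ`
  rw [Fintype.sum_equiv (Equiv.mulLeft γ)
    (fun σ ↦ (s σ : ℤ) • pointGalHom cm7 (ringClassField K ι 1 : Type) (γ * σ).1 y)
    (fun σ' ↦ (s (γ⁻¹ * σ') : ℤ) • pointGalHom cm7 (ringClassField K ι 1 : Type) σ'.1 y)
    (fun σ ↦ by simp only [Equiv.coe_mulLeft, inv_mul_cancel_left])]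
  refine Finset.sum_congr rfl fun σ' _ ↦ ?_
  rw [hsmul, sign_inv_eq s hsmul γ, Units.val_mul, mul_smul]

include hsmul in
/-- **`γ • (ρ • P_χ) = s(γ) • ρ • P_χ`** for `γ ∈ 𝒢` and `ρ ∈ Aut(H/ℚ) ∖ 𝒢`: the dihedral relation
`ρ γ⁻¹ ρ⁻¹ = γ`, i.e. `γ ρ = ρ γ⁻¹` (Cox Lemma 9.3; tree `mul_mul_inv_eq_inv_of_not_mem_ringClassGal`), and §1.
[cite: Cox2013, §9.A Lemma 9.3] -/
theorem pointGalHom_genusSum_of_not_mem [NumberField (ringClassField K ι 1)] (hK : IsImaginaryQuadratic K)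
    {ρ : ringClassField K ι 1 ≃ₐ[ℚ] ringClassField K ι 1} (hρ : ρ ∉ ringClassGal ι 1) (γ : ringClassGal ι 1) :
    pointGalHom cm7 (ringClassField K ι 1 : Type) γ.1 (pointGalHom cm7 (ringClassField K ι 1 : Type) ρ
        (∑ σ : ringClassGal ι 1, (s σ : ℤ) • pointGalHom cm7 (ringClassField K ι 1 : Type) σ.1 y)) =
      (s γ : ℤ) • pointGalHom cm7 (ringClassField K ι 1 : Type) ρ
        (∑ σ : ringClassGal ι 1, (s σ : ℤ) • pointGalHom cm7 (ringClassField K ι 1 : Type) σ.1 y) := by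
  have hdih := mul_mul_inv_eq_inv_of_not_mem_ringClassGal hK ι one_ne_zero hρ ((ringClassGal ι 1).inv_mem γ.2)
  -- `ρ γ⁻¹ ρ⁻¹ = γ`, so `γ ρ = ρ γ⁻¹`
  rw [inv_inv] at hdih
  have hcomm : γ.1 * ρ = ρ * γ.1⁻¹ := by
    calc γ.1 * ρ = (ρ * γ.1⁻¹ * ρ⁻¹) * ρ := by rw [hdih]
      _ = ρ * γ.1⁻¹ := by group
  have h := congrArg (fun f : AddMonoid.End (cm7.baseChange (ringClassField K ι 1 : Type)).toAffine.Point ↦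
    f (∑ σ : ringClassGal ι 1, (s σ : ℤ) • pointGalHom cm7 (ringClassField K ι 1 : Type) σ.1 y))
    (congrArg (pointGalHom cm7 (ringClassField K ι 1 : Type)) hcomm)
  simp only [map_mul] at h
  change pointGalHom cm7 _ γ.1 (pointGalHom cm7 _ ρ _) = pointGalHom cm7 _ ρ (pointGalHom cm7 _ γ.1⁻¹ _) at h
  rw [h]
  have h3 := pointGalHom_genusSum_of_mem s hsmul y γ⁻¹
  rw [sign_inv_eq s hsmul γ] at h3
  have h4 : pointGalHom cm7 (ringClassField K ι 1 : Type) γ.1⁻¹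
      (∑ σ : ringClassGal ι 1, (s σ : ℤ) • pointGalHom cm7 (ringClassField K ι 1 : Type) σ.1 y) =
      (s γ : ℤ) • ∑ σ : ringClassGal ι 1, (s σ : ℤ) • pointGalHom cm7 (ringClassField K ι 1 : Type) σ.1 y := by
    convert h3 using 2
    simp
  rw [h4, map_zsmul]

/-- **The sign of every `σ ∈ Aut(H/ℚ)` on `Q_ρ = P + ρ P`.** Let `ρ ∈ Aut(H/ℚ) ∖ 𝒢` be an involution
(`ρ² = 1`) fixing an element `u ≠ 0` with `u² = d ∈ ℚ`; let `P ∈ X₀(49)(H)` with `γ P = s(γ) P` and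
`γ (ρ P) = s(γ) ρ P` for `γ ∈ 𝒢` (§1 for the genus point), where `s` is the cut-out character of `u` on `𝒢`
(`γ u = u ⟺ s γ = 1`). Then for every `σ ∈ Aut(H/ℚ)`: `σ Q_ρ = Q_ρ` if `σ u = u` and `σ Q_ρ = −Q_ρ` otherwise
(`σ ∈ 𝒢`: directly; `σ = ρ γ`, `γ ∈ 𝒢` — `[Aut(H/ℚ) : 𝒢] = 2`, tree `inv_mul_mem_ringClassGal_of_not_mem` —:
`σ Q_ρ = s(γ) ρ Q_ρ = s(γ) Q_ρ` and `σ u = ρ(±u) = ±u`). [cite: Cox2013, §9.A Lemma 9.3] [cite: Gross1984, §5] -/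
theorem pointGalHom_add_involution_of_sign (hK : IsImaginaryQuadratic K)
    {ρ : ringClassField K ι 1 ≃ₐ[ℚ] ringClassField K ι 1} (hρ : ρ ∉ ringClassGal ι 1) (hρ2 : ρ * ρ = 1)
    {u : ringClassField K ι 1} {d : ℚ} (hu : u ^ 2 = algebraMap ℚ (ringClassField K ι 1) d) (hu0 : u ≠ 0)
    (hρu : ρ u = u) (hsu : ∀ γ : ringClassGal ι 1, γ.1 u = u ↔ s γ = 1)
    (P : (cm7.baseChange (ringClassField K ι 1 : Type)).toAffine.Point)
    (h1 : ∀ γ : ringClassGal ι 1, pointGalHom cm7 (ringClassField K ι 1 : Type) γ.1 P = (s γ : ℤ) • P)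
    (h2 : ∀ γ : ringClassGal ι 1, pointGalHom cm7 (ringClassField K ι 1 : Type) γ.1
      (pointGalHom cm7 (ringClassField K ι 1 : Type) ρ P) = (s γ : ℤ) • pointGalHom cm7 (ringClassField K ι 1 : Type) ρ P)
    (σ : ringClassField K ι 1 ≃ₐ[ℚ] ringClassField K ι 1) :
    (σ u = u → pointGalHom cm7 (ringClassField K ι 1 : Type) σ (P + pointGalHom cm7 (ringClassField K ι 1 : Type) ρ P) =
      P + pointGalHom cm7 (ringClassField K ι 1 : Type) ρ P) ∧
    (σ u ≠ u → pointGalHom cm7 (ringClassField K ι 1 : Type) σ (P + pointGalHom cm7 (ringClassField K ι 1 : Type) ρ P) =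
      -(P + pointGalHom cm7 (ringClassField K ι 1 : Type) ρ P)) := by
  have hneg : -u ≠ u := fun h ↦ hu0 (by
    have : (2 : ringClassField K ι 1) * u = 0 := by linear_combination -h
    simpa using this)
  -- value of `s` off the kernel
  have hs : ∀ γ : ringClassGal ι 1, ¬ γ.1 u = u → s γ = -1 := fun γ h ↦
    (Int.units_eq_one_or (s γ)).resolve_left fun h1 ↦ h ((hsu γ).mpr h1)
  -- `σ Q = s(γ) • Q` for the relevant `γ ∈ 𝒢`, and the sign of `σ` on `u` is that of `γ`
  have key : ∃ γ : ringClassGal ι 1, (σ u = u ↔ γ.1 u = u) ∧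
      pointGalHom cm7 (ringClassField K ι 1 : Type) σ (P + pointGalHom cm7 (ringClassField K ι 1 : Type) ρ P) =
        (s γ : ℤ) • (P + pointGalHom cm7 (ringClassField K ι 1 : Type) ρ P) := by
    by_cases hσ : σ ∈ ringClassGal ι 1
    · exact ⟨⟨σ, hσ⟩, Iff.rfl, by rw [map_add, h1 ⟨σ, hσ⟩, h2 ⟨σ, hσ⟩, ← smul_add]⟩
    · -- `σ = ρ γ` with `γ = ρ⁻¹ σ ∈ 𝒢`
      have hγ : ρ⁻¹ * σ ∈ ringClassGal ι 1 := inv_mul_mem_ringClassGal_of_not_mem hK ι 1 hρ hσ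
      have hσeq : σ = ρ * (ρ⁻¹ * σ) := by group
      have hρρ : pointGalHom cm7 (ringClassField K ι 1 : Type) ρ (pointGalHom cm7 (ringClassField K ι 1 : Type) ρ P)
          = P := by
        have h : pointGalHom cm7 (ringClassField K ι 1 : Type) ρ (pointGalHom cm7 (ringClassField K ι 1 : Type) ρ P)
            = pointGalHom cm7 (ringClassField K ι 1 : Type) (ρ * ρ) P := by
          rw [map_mul]; rfl
        rw [h, hρ2, map_one]
        rfl
      refine ⟨⟨ρ⁻¹ * σ, hγ⟩, ?_, ?_⟩
      · -- `σ u = ρ (γ u)` with `γ u = ±u`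
        have hσu : σ u = ρ ((ρ⁻¹ * σ) u) := by
          conv_lhs => rw [hσeq]
          rfl
        change σ u = u ↔ (ρ⁻¹ * σ) u = u
        rcases apply_sqrt_eq_self_or_neg (k := ℚ) (ρ⁻¹ * σ) hu with h | h
        · rw [hσu, h, hρu]
        · rw [hσu, h, map_neg, hρu]
      · conv_lhs => rw [hσeq]
        rw [map_mul]
        change pointGalHom cm7 _ ρ (pointGalHom cm7 _ (⟨ρ⁻¹ * σ, hγ⟩ : ringClassGal ι 1).1 (P + pointGalHom cm7 _ ρ P))
          = _
        rw [map_add, h1, h2, map_add, map_zsmul, map_zsmul, hρρ, smul_add, add_comm]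
  obtain ⟨γ, hiff, hval⟩ := key
  constructor
  · intro h
    rw [hval, (hsu γ).mp (hiff.mp h), Units.val_one, one_zsmul]
  · intro h
    rw [hval, hs γ (fun h' ↦ h (hiff.mpr h')), Units.val_neg, Units.val_one, neg_one_zsmul]

end SignAction

/-! ## §2 Descent through the twist substitution: a `±`-eigenpoint for the cut-out character of `u` is
`Φ_H(ι_H(z))` with `z` RATIONAL on the twist by `u²` -/

section Descent

-- every point group below is read against the classical decidability instance (the world of the generic tree
-- lemmas `twistPointEquivOver`, `exists_map_eq_of_forall_map_galois_eq`); the exported statement takes the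
-- instance as the binder `hdec` and specialises it first (a subsingleton).
attribute [local instance 2000] Classical.propDecidable

variable {K : Type} [Field K] [NumberField K] {ι : K →+* ℂ}

/-- **Rationality on the twist.** Let `u ∈ H = K[1]`, `u ∉ ℚ`, `u² = d ∈ ℚ`, and `Q ∈ X₀(49)(H)` with
`σ Q = Q` when `σ u = u` and `σ Q = −Q` when `σ u ≠ u`, for every `σ ∈ Aut(H/ℚ)`. Then `Q = Φ_H(ι_H(z))` for a
RATIONAL point `z ∈ X₀(49)^{(d)}(ℚ)` (`Φ_H` the twist substitution for `t = u`, `ι_H` the inclusion of `ℚ`-points):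
`Φ_H⁻¹ Q` is fixed by all of `Aut(H/ℚ)` (naturality / anti-naturality of `Φ_H`, cell `b2b-bsdres`), and `H/ℚ` is
Galois (Cox Lemma 9.3; tree `isGalois_rat_ringClassField`), so Galois descent (`exists_map_eq_of_forall_map_galois_eq`)
applies. [cite: SilvermanAEC2009, X.2 Prop. 2.4 and I.§1] [cite: Dokchitser2013ParityNotes, §4] [cite: Cox2013, §9.A Lemma 9.3] -/
theorem exists_twist_point_of_forall_pointGalHom [hdec : DecidableEq (ringClassField K ι 1)]
    (hK : IsImaginaryQuadratic K)
    {u : ringClassField K ι 1} {d : ℚ} (huQ : u ∉ Set.range (algebraMap ℚ (ringClassField K ι 1)))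
    (hu : u ^ 2 = algebraMap ℚ (ringClassField K ι 1) d) (Q : (cm7.baseChange (ringClassField K ι 1 : Type)).toAffine.Point)
    (hQ : ∀ σ : ringClassField K ι 1 ≃ₐ[ℚ] ringClassField K ι 1,
      (σ u = u → pointGalHom cm7 (ringClassField K ι 1 : Type) σ Q = Q) ∧
      (σ u ≠ u → pointGalHom cm7 (ringClassField K ι 1 : Type) σ Q = -Q)) :
    ∃ z : (cm7.quadraticTwist d).toAffine.Point,
      twistPointEquivOver cm7 huQ hu (QuadraticDescent.incl (ringClassField K ι 1 : Type) (cm7.quadraticTwist d) z)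
        = Q := by
  have hworld : hdec = fun a b ↦ Classical.propDecidable (a = b) := Subsingleton.elim _ _
  subst hworld
  haveI := (finiteDimensional_and_isGalois_ringClassField hK ι one_ne_zero).1
  haveI : FiniteDimensional ℚ (ringClassField K ι 1) := Module.Finite.trans K _
  haveI : IsGalois ℚ (ringClassField K ι 1) := isGalois_rat_ringClassField hK ι one_ne_zero
  have hu0 : u ≠ 0 := by
    rintro rfl
    exact huQ ⟨0, by simp⟩
  have hneg : -u ≠ u := fun h ↦ hu0 (by
    have : (2 : ringClassField K ι 1) * u = 0 := by linear_combination -h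
    simpa using this)
  have hΦR : twistPointEquivOver cm7 huQ hu ((twistPointEquivOver cm7 huQ hu).symm Q) = Q :=
    (twistPointEquivOver cm7 huQ hu).apply_symm_apply Q
  -- `R = Φ⁻¹ Q` is fixed by every `σ ∈ Aut(H/ℚ)`
  have hfix : ∀ σ : ringClassField K ι 1 ≃ₐ[ℚ] ringClassField K ι 1,
      Affine.Point.map (W' := cm7.quadraticTwist d) (σ : ringClassField K ι 1 →ₐ[ℚ] ringClassField K ι 1)
        ((twistPointEquivOver cm7 huQ hu).symm Q) = (twistPointEquivOver cm7 huQ hu).symm Q := by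
    intro σ
    rcases apply_sqrt_eq_self_or_neg (k := ℚ) σ hu with h | h
    · have hQσ := (hQ σ).1 h
      rw [pointGalHom_apply, ← hΦR, map_twistPointEquivOver cm7 huQ hu huQ hu
        (σ : ringClassField K ι 1 →ₐ[ℚ] ringClassField K ι 1) h _] at hQσ
      exact (twistPointEquivOver cm7 huQ hu).injective hQσ
    · have h' : ¬ σ u = u := by rw [h]; exact hneg
      have hQσ := (hQ σ).2 h'
      rw [pointGalHom_apply, ← hΦR, map_twistPointEquivOver_of_neg cm7 huQ hu huQ hu
        (σ : ringClassField K ι 1 →ₐ[ℚ] ringClassField K ι 1) h _, neg_inj] at hQσ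
      exact (twistPointEquivOver cm7 huQ hu).injective hQσ
  obtain ⟨z, hz⟩ := exists_map_eq_of_forall_map_galois_eq (cm7.quadraticTwist d) (k := ℚ)
    (L := (ringClassField K ι 1 : Type)) hfix
  refine ⟨z, ?_⟩
  have hom : Algebra.ofId ℚ (ringClassField K ι 1) = (algebraMap ℚ (ringClassField K ι 1)).toRatAlgHom :=
    AlgHom.ext fun q ↦ by simp
  have hincl : QuadraticDescent.incl (ringClassField K ι 1 : Type) (cm7.quadraticTwist d) z =
      Affine.Point.map (W' := cm7.quadraticTwist d) (algebraMap ℚ (ringClassField K ι 1)).toRatAlgHom z :=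
    congrArg (fun f : ℚ →ₐ[ℚ] ringClassField K ι 1 ↦ Affine.Point.map (W' := cm7.quadraticTwist d) f z) hom
  rw [hincl.trans hz, hΦR]

end Descent

/-! ## §3 The cut-out sign is multiplicative; `49a1^{(a)}(ℚ)` is finite; the CORE decomposition `2P = Q_a + Q_n` -/

section Conj

attribute [local instance 2000] Classical.propDecidable

variable {K : Type} [Field K] [NumberField K] {ι : K →+* ℂ}

/-- **Multiplicativity of the cut-out sign**: if `γ r₀ = r₀ ⟺ s γ = 1` on `𝒢` with `r₀² ∈ ℚ`, `r₀ ≠ 0`, then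
`s (γσ) = s γ · s σ` (the quadratic character of `K(r₀)/K` read on `Gal(H/K)`; `ℤˣ = {±1}`). [folklore] -/
theorem sign_mul_of_cutout {r₀ : ringClassField K ι 1} {d : ℚ} (hr : r₀ ^ 2 = algebraMap ℚ (ringClassField K ι 1) d)
    (hr0 : r₀ ≠ 0) (s : ringClassGal ι 1 → ℤˣ) (hcut : ∀ γ : ringClassGal ι 1, γ.1 r₀ = r₀ ↔ s γ = 1)
    (γ σ : ringClassGal ι 1) : s (γ * σ) = s γ * s σ := by
  have hneg : -r₀ ≠ r₀ := fun h ↦ hr0 (by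
    have : (2 : ringClassField K ι 1) * r₀ = 0 := by linear_combination -h
    simpa using this)
  have val : ∀ γ : ringClassGal ι 1, (γ.1 r₀ = r₀ ∧ s γ = 1) ∨ (γ.1 r₀ = -r₀ ∧ s γ = -1) := fun γ ↦ by
    rcases apply_sqrt_eq_self_or_neg (k := ℚ) γ.1 hr with h | h
    · exact Or.inl ⟨h, (hcut γ).mp h⟩
    · refine Or.inr ⟨h, (Int.units_eq_one_or (s γ)).resolve_left fun h1 ↦ hneg ?_⟩
      rw [← h]; exact (hcut γ).mpr h1
  have hmul : (γ * σ).1 r₀ = γ.1 (σ.1 r₀) := rfl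
  rcases val γ with ⟨hγ, sγ⟩ | ⟨hγ, sγ⟩ <;> rcases val σ with ⟨hσ, sσ⟩ | ⟨hσ, sσ⟩
  · have h : (γ * σ).1 r₀ = r₀ := by rw [hmul, hσ, hγ]
    rw [(hcut _).mp h, sγ, sσ, one_mul]
  · have h : (γ * σ).1 r₀ = -r₀ := by rw [hmul, hσ, map_neg, hγ]
    rcases val (γ * σ) with ⟨h', -⟩ | ⟨-, sp⟩
    · exact absurd (h.symm.trans h') hneg
    · rw [sp, sγ, sσ, one_mul]
  · have h : (γ * σ).1 r₀ = -r₀ := by rw [hmul, hσ, hγ]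
    rcases val (γ * σ) with ⟨h', -⟩ | ⟨-, sp⟩
    · exact absurd (h.symm.trans h') hneg
    · rw [sp, sγ, sσ, mul_one]
  · have h : (γ * σ).1 r₀ = r₀ := by rw [hmul, hσ, map_neg, hγ, neg_neg]
    rw [(hcut _).mp h, sγ, sσ]
    simp

/-- **`49a1^{(a)}(ℚ)` is finite** for a prime `a ≡ 1 (mod 4)` inert in `ℚ(√−7)`: Coates–Li–Tian–Zhai 2015 Thm 1.2
(`h12`: `rank 49a1^{(a)}(ℚ) = 0` on a global minimal model) and Mordell–Weil (`finite_point_of_rank_zero`), transported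
to the twisted equation. [cite: CoatesLiTianZhai2015, Thm. 1.2 (p. 359, case r = 1)] [cite: SilvermanAEC2009, Thm. VIII.6.7] -/
theorem finite_point_cm7_quadraticTwist_prime (h12 : CoatesLiTianZhai2015.thm12_fullBSD_twist) {a : ℕ}
    (ha : a.Prime) (ha4 : a % 4 = 1) (ha7 : jacobiSym (-7) a = -1) :
    Finite (cm7.quadraticTwist (a : ℚ)).toAffine.Point := by
  have ha0 : (a : ℚ) ≠ 0 := by exact_mod_cast ha.ne_zero
  obtain ⟨Wa, hEa, hMa, Ca, hCa⟩ := exists_isGloballyMinimal_smul_eq_quadraticTwist cm7 ha0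
  haveI := hEa; haveI := hMa
  have hrank : Wa.mordellWeilRank = 0 := (h12 a (CoatesLiTianZhai2015.inertProduct_prime ha ha4 ha7) Wa ⟨Ca, hCa⟩).2.1
  haveI := WeierstrassCurve.finite_point_of_rank_zero Wa hrank
  exact Finite.of_equiv Wa.toAffine.Point
    ((VariableChange.pointEquiv Wa Ca).toEquiv.trans (Affine.Point.congrEquiv hCa).toEquiv)

/-- **CORE of the decomposition.** Data: the cut-out sign `s` of `r₀` (`r₀² = a`, `r₀ ∉ ℚ`) on `𝒢 = Gal(H/K)`, an
element `t ∉ ℚ` with `t² = n` whose cut-out sign on `𝒢` is ALSO `s`, two involutions `ρ_a, ρ_n ∈ Aut(H/ℚ) ∖ 𝒢`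
with `ρ_a r₀ = r₀`, `ρ_n t = t`, and a point `P ∈ X₀(49)(H)` with `γ P = s(γ) P` (`γ ∈ 𝒢`), `γ (ρ P) = s(γ) ρ P`
(`γ ∈ 𝒢`, `ρ ∉ 𝒢`) and `ρ_a P + ρ_n P = 0`. Then `2P = Φ_H^{(t)}(ι z) + T` with `z ∈ X₀(49)^{(n)}(ℚ)` and `T` of finite
order — `T = P + ρ_a P = Φ_H^{(r₀)}(ι z_a)` with `z_a` in the FINITE group `X₀(49)^{(a)}(ℚ)` (`hfin`).
[cite: Gross1984, §5] [cite: SilvermanAEC2009, X.2 Prop. 2.4] -/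
theorem two_smul_eq_twist_add_torsion_of_involutions [hdec : DecidableEq (ringClassField K ι 1)]
    (hK : IsImaginaryQuadratic K) {n : ℤ} {a : ℕ} (hfin : Finite (cm7.quadraticTwist (a : ℚ)).toAffine.Point)
    (s : ringClassGal ι 1 → ℤˣ)
    {r₀ : ringClassField K ι 1} (hr₀Q : r₀ ∉ Set.range (algebraMap ℚ (ringClassField K ι 1)))
    (hr₀ : r₀ ^ 2 = algebraMap ℚ (ringClassField K ι 1) (a : ℚ))
    (hcut : ∀ γ : ringClassGal ι 1, γ.1 r₀ = r₀ ↔ s γ = 1)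
    {t : ringClassField K ι 1} (htQ : t ∉ Set.range (algebraMap ℚ (ringClassField K ι 1)))
    (htn : t ^ 2 = algebraMap ℚ (ringClassField K ι 1) (n : ℚ))
    (hcut' : ∀ γ : ringClassGal ι 1, γ.1 t = t ↔ s γ = 1)
    {ρa ρn : ringClassField K ι 1 ≃ₐ[ℚ] ringClassField K ι 1} (hρa : ρa ∉ ringClassGal ι 1) (hρa2 : ρa * ρa = 1)
    (hρar : ρa r₀ = r₀) (hρn : ρn ∉ ringClassGal ι 1) (hρn2 : ρn * ρn = 1) (hρnt : ρn t = t)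
    (P : (cm7.baseChange (ringClassField K ι 1 : Type)).toAffine.Point)
    (h1 : ∀ γ : ringClassGal ι 1, pointGalHom cm7 (ringClassField K ι 1 : Type) γ.1 P = (s γ : ℤ) • P)
    (h2 : ∀ (ρ : ringClassField K ι 1 ≃ₐ[ℚ] ringClassField K ι 1), ρ ∉ ringClassGal ι 1 → ∀ γ : ringClassGal ι 1,
      pointGalHom cm7 (ringClassField K ι 1 : Type) γ.1 (pointGalHom cm7 (ringClassField K ι 1 : Type) ρ P) =
        (s γ : ℤ) • pointGalHom cm7 (ringClassField K ι 1 : Type) ρ P)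
    (hsum : pointGalHom cm7 (ringClassField K ι 1 : Type) ρa P + pointGalHom cm7 (ringClassField K ι 1 : Type) ρn P = 0) :
    ∃ (z : (cm7.quadraticTwist (n : ℚ)).toAffine.Point) (T : (cm7.baseChange (ringClassField K ι 1 : Type)).toAffine.Point),
      IsOfFinAddOrder T ∧
      (2 : ℤ) • P = twistPointEquivOver cm7 htQ htn
          (QuadraticDescent.incl (ringClassField K ι 1 : Type) (cm7.quadraticTwist (n : ℚ)) z) + T := by
  have hworld : hdec = fun a b ↦ Classical.propDecidable (a = b) := Subsingleton.elim _ _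
  subst hworld
  have hr₀0 : r₀ ≠ 0 := by
    rintro rfl
    exact hr₀Q ⟨0, by simp⟩
  have ht0 : t ≠ 0 := by
    rintro rfl
    exact htQ ⟨0, by simp⟩
  -- the two `±`-eigenpoints
  have hQa := pointGalHom_add_involution_of_sign s hK hρa hρa2 hr₀ hr₀0 hρar hcut P h1 (h2 ρa hρa)
  have hQn := pointGalHom_add_involution_of_sign s hK hρn hρn2 htn ht0 hρnt hcut' P h1 (h2 ρn hρn)
  obtain ⟨za, hza⟩ := exists_twist_point_of_forall_pointGalHom hK hr₀Q hr₀ _ hQa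
  obtain ⟨zn, hzn⟩ := exists_twist_point_of_forall_pointGalHom hK htQ htn _ hQn
  refine ⟨zn, P + pointGalHom cm7 (ringClassField K ι 1 : Type) ρa P, ?_, ?_⟩
  · -- `Q_a = Φ(ι z_a)` with `z_a` in a finite group
    haveI := hfin
    rw [← hza]
    exact ((twistPointEquivOver cm7 hr₀Q hr₀).toAddMonoidHom.comp
      (QuadraticDescent.incl (ringClassField K ι 1 : Type) (cm7.quadraticTwist (a : ℚ)))).isOfFinAddOrder
      (isOfFinAddOrder_of_finite za)
  · rw [hzn]
    -- `2P = (P + ρ_n P) + (P + ρ_a P)` as `ρ_a P + ρ_n P = 0`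
    have h : pointGalHom cm7 (ringClassField K ι 1 : Type) ρn P = -pointGalHom cm7 (ringClassField K ι 1 : Type) ρa P :=
      eq_neg_of_add_eq_zero_right hsum
    rw [h, two_zsmul]
    abel

end Conj

end Summit.BirchSwinnertonDyer.BirchSwinnertonDyer.Theorems.GoldfeldGoodTwists

end
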